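import Literature.NumberTheory.EllipticCurves.FormalGroupChart
import Literature.NumberTheory.EllipticCurves.GaloisAction
import Literature.NumberTheory.GaloisRepresentations.AbsGaloisGroup
import Mathlib.FieldTheory.Galois.Infinite
import HarnessLib

/-! # The product of the parameters `z = -x/y` over a rational cyclic subgroup is rational —
# stub `stub_lineProduct` of line `Sketch`, crux `MazurKenkuBound` (stmt-ABC-15125)

WHAT. For an elliptic curve `W/ℚ`, a prime `N` and a point `P ∈ E[N](ℚ̄)` spanning a
`Γ_ℚ`-stable line (`σ • P = r(σ) • P` for a character `r : Γ_ℚ → (ℤ/Nℤ)ˣ`), the product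
`∏_{a=1}^{N-1} z(aP)` of the local parameters `z = -x/y` (tree
`WeierstrassCurve.Affine.Point.zCoord`) over the nonzero points of the line is a rational number.

SOURCE. Folklore Galois descent (Silverman, *AEC*, VIII.§1; the step is used in Mazur 1978,
proof of Prop. 5.1): `Γ_ℚ` acts on coordinates, hence `σ(z(Q)) = z(σ • Q)`; it permutes the
nonzero points `aP`, `1 ≤ a ≤ N - 1`, of the line (`σ • aP = (a r(σ) mod N) P` and
`a ↦ a r(σ) mod N` is a permutation of `{1, …, N-1}`), so the product is `Γ_ℚ`-invariant; an
element of `ℚ̄` fixed by `Γ_ℚ = Gal(ℚ̄/ℚ)` is rational (infinite Galois theory, Mathlib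
`InfiniteGalois.mem_range_algebraMap_iff_fixed`).

DESIGN. Everything except the last line is proved for a general base field `F` (so that the
`F`-algebra structure on `AlgebraicClosure F` is unambiguous); the deliverable specialises to
`F = ℚ`, where the statement is read through the (definitionally equal) `ℚ`-algebra structure
found by instance resolution. -/

-- `Summit.<Summit>.<Problem>` is the mandated summit-side namespace (CONVENTIONS §2); for the
-- single-conjunct summit `ABC` the two coincide, so the duplicate `ABC.ABC` is deliberate.
set_option linter.dupNamespace false

noncomputable section

open scoped NNReal Classical
open WeierstrassCurve Field Literature.NumberTheory.EllipticCurves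

namespace Summit.ABC.ABC.Theorems

universe u

/-- The parameter `z = -x/y` is compatible with the Galois action on geometric points:
`z(σ • Q) = σ(z(Q))` for `σ ∈ Γ_F` and `Q ∈ E(F̄)` (the action is on coordinates).
Silverman, *AEC*, VIII.§1. [folklore] -/
private theorem zCoord_absGal_smul {F : Type u} [Field F] (W : WeierstrassCurve F)
    (σ : absoluteGaloisGroup F) (Q : geomPoints W) :
    Affine.Point.zCoord (σ • Q) = σ • Affine.Point.zCoord Q := by
  rw [Field.absoluteGaloisGroup.smul_def]
  change Affine.Point.zCoord (Affine.Point.map (W' := W)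
    ((absoluteGaloisGroup.toAlgEquiv F σ : AlgebraicClosure F ≃ₐ[F] AlgebraicClosure F) :
      AlgebraicClosure F →ₐ[F] AlgebraicClosure F) Q) = _
  rcases Q with _ | ⟨x, y, h⟩
  · exact (map_zero _).symm
  · rw [Affine.Point.map_some, Affine.Point.zCoord_some, Affine.Point.zCoord_some, map_div₀,
      map_neg]
    rfl

/-- Multiplication by an integer `c` prime to `N` is injective on the residues `{1, …, N - 1}`
modulo `N`. [folklore] -/
private theorem injOn_mulMod_Ico {N c : ℕ} (hc : c.Coprime N) :
    Set.InjOn (fun a => a * c % N) ↑(Finset.Ico 1 N) := by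
  intro a ha b hb hab
  rw [Finset.coe_Ico, Set.mem_Ico] at ha hb
  exact Nat.ModEq.eq_of_lt_of_lt (Nat.ModEq.cancel_right_of_coprime hc.symm hab) ha.2 hb.2

/-- Multiplication by an integer `c` prime to `N` permutes the residues `{1, …, N - 1}`
modulo `N`. [folklore] -/
private theorem image_mulMod_Ico {N c : ℕ} (hc : c.Coprime N) :
    (Finset.Ico 1 N).image (fun a => a * c % N) = Finset.Ico 1 N := by
  apply Finset.eq_of_subset_of_card_le
  · intro b hb
    obtain ⟨a, ha, rfl⟩ := Finset.mem_image.mp hb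
    rw [Finset.mem_Ico] at ha ⊢
    refine ⟨Nat.one_le_iff_ne_zero.mpr fun h0 => ?_, Nat.mod_lt _ (by omega)⟩
    have hdvd : N ∣ a := hc.symm.dvd_of_dvd_mul_right (Nat.dvd_of_mod_eq_zero h0)
    exact absurd (Nat.eq_zero_of_dvd_of_lt hdvd ha.2) (by omega)
  · rw [Finset.card_image_of_injOn (injOn_mulMod_Ico hc)]

/-- Reindexing a product over `{1, …, N - 1}` by multiplication by a unit modulo `N`.
[folklore] -/
private theorem prod_Ico_mulMod {M : Type*} [CommMonoid M] {N c : ℕ} (hc : c.Coprime N)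
    (g : ℕ → M) : ∏ a ∈ Finset.Ico 1 N, g (a * c % N) = ∏ a ∈ Finset.Ico 1 N, g a := by
  rw [← Finset.prod_image (f := g) (injOn_mulMod_Ico hc), image_mulMod_Ico hc]

/-- **Galois invariance of the product of the parameters over a stable line.** If `P ∈ E[N](F̄)`
satisfies `σ • P = u • P` for some `σ ∈ Γ_F` and a unit `u` modulo `N`, then `σ` fixes
`∏_{a=1}^{N-1} z(aP)`: `σ(z(aP)) = z(σ • aP) = z((a u mod N) P)` and `a ↦ a u mod N` permutes
`{1, …, N - 1}`. Silverman, *AEC*, VIII.§1 (Galois action on points). [folklore] -/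
private theorem smul_prod_zCoord_line {F : Type u} [Field F] {W : WeierstrassCurve F} {N : ℕ}
    (P : geomTorsion W N) (σ : absoluteGaloisGroup F) (u : (ZMod N)ˣ)
    (hσ : σ • P = (u : ZMod N).val • P) :
    σ • (∏ a ∈ Finset.Ico 1 N, Affine.Point.zCoord (a • (P : geomPoints W))) =
      ∏ a ∈ Finset.Ico 1 N, Affine.Point.zCoord (a • (P : geomPoints W)) := by
  have hcN : (u : ZMod N).val.Coprime N := ZMod.val_coe_unit_coprime u
  have hσ' : σ • (P : geomPoints W) = (u : ZMod N).val • (P : geomPoints W) := by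
    have h := congrArg Subtype.val hσ
    rwa [Literature.NumberTheory.EllipticCurves.AddSubgroup.torsionBy.coe_smul,
      AddSubgroup.coe_nsmul] at h
  have hmul : ∀ a : ℕ,
      σ • (a • (P : geomPoints W)) = (a * (u : ZMod N).val % N) • (P : geomPoints W) := by
    intro a
    rw [smul_comm σ a, hσ', smul_smul]
    exact AddSubgroup.torsionBy.mod_self_nsmul' _ P.2
  rw [Finset.smul_prod']
  simp_rw [← zCoord_absGal_smul, hmul]
  exact prod_Ico_mulMod hcN (fun b => Affine.Point.zCoord (b • (P : geomPoints W)))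

/-- In characteristic zero an element of `F̄` fixed by `Γ_F = Gal(F̄/F)` lies in `F`
(infinite Galois theory: the fixed field of the whole group is the base).
Neukirch, *Algebraic Number Theory*, IV.§1. [folklore] -/
private theorem exists_algebraMap_eq_of_fixed {F : Type u} [Field F] [CharZero F]
    {x : AlgebraicClosure F} (hx : ∀ σ : absoluteGaloisGroup F, σ • x = x) :
    ∃ c : F, algebraMap F (AlgebraicClosure F) c = x :=
  (InfiniteGalois.mem_range_algebraMap_iff_fixed x).mpr fun f =>
    hx ((absoluteGaloisGroup.toAlgEquiv F).symm f)

/-- **The product of the parameters over a rational cyclic subgroup is rational**: for an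
elliptic `W/ℚ`, a prime `N` and `P ∈ E[N] ∖ 0` spanning a `Γ_ℚ`-stable line (character `r`),
`∏_{a=1}^{N-1} z(aP) ∈ ℚ` (`Γ_ℚ` permutes the nonzero points of the line and acts on
coordinates, so the product is `Γ_ℚ`-invariant; an element of `ℚ̄` fixed by `Γ_ℚ` is rational).
Silverman, *AEC*, VIII.§1; Mazur 1978, proof of Prop. 5.1. [folklore] -/
theorem stub_lineProduct (W : WeierstrassCurve ℚ) [W.IsElliptic] (N : ℕ) [Fact N.Prime]
    {P : geomTorsion W N} (hP0 : P ≠ 0) {r : absoluteGaloisGroup ℚ →* (ZMod N)ˣ}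
    (hr : ∀ σ : absoluteGaloisGroup ℚ, σ • P = ((r σ : (ZMod N)ˣ) : ZMod N).val • P) :
    ∃ q : ℚ, (∏ a ∈ Finset.Ico 1 N,
      Affine.Point.zCoord (a • ((P : geomPoints W) : (W.baseChange (AlgebraicClosure ℚ)).toAffine.Point))) =
        (q : AlgebraicClosure ℚ) := by
  -- `hP0` is not needed (for `P = 0` the product is `0`); the registered signature carries it,
  -- and the trivial case split keeps the binder referenced.
  by_cases h0 : P = 0
  · exact absurd h0 hP0
  obtain ⟨q, hq⟩ := exists_algebraMap_eq_of_fixed (F := ℚ) fun σ =>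
    smul_prod_zCoord_line P σ (r σ) (hr σ)
  rw [eq_ratCast] at hq
  exact ⟨q, hq.symm⟩

end Summit.ABC.ABC.Theorems

end
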